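import Mathlib
import Summits.MatrixMultiplication.Statement
import Summits.MatrixMultiplication.MatrixMultiplication.Theorems.GraphEquationsPolarLemma
import Summits.MatrixMultiplication.MatrixMultiplication.Theorems.GraphEquationsTangentDeflation
import Summits.MatrixMultiplication.MatrixMultiplication.Theorems.GraphEquationsRowCriterion

/-!
# GraphEquations — JET REGULARITY: initial isolation to order two gives the regularity half of
# jet truncation, at any base (M18c, decomp-mm-lens-5 g31)

(supports `MultiplicityReduction`, stmt-MatrixMultiplication-27806, hand 1 = BOP′ at `K = 2`.)

The jet-truncation engine (module `GraphEquationsJetTruncation`) needs, at a graph base point `x₀`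
and for a tangent `γ ∈ ker J_C(x₀)`, two things: (LIFT) `γ` extends to a kernel 2-jet of the
Jacobian rows in the `a ⊗ b`-directions, and (REG) `J p = 0 ∧ G_γ p ∈ colspace J ⇒ p = 0`, where
`J = J_C(x₀)` and `G_γ(o,q) = Σ_{q'} γ_{q'} (∂²t_o/∂c_q ∂c_{q'})(x₀)` are the POLAR ROWS (the linear
`C`-coefficients of the deflated tests `D_ξ t_o`, for any field `ξ` with `ξ(x₀) = γ`).

This module proves REG from the tree's rung-2 hypothesis:

* `InitIsolatedFam.translate` — initial isolation is TRANSPORTED by the translation symmetry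
  `τ_y` of `W_n`: `InitIsolatedFam u K y → InitIsolatedFam (τ_y^* u) K 0` (`τ_y` fixes every `F_q`
  and shifts the coefficients, tree `translate_substF`).
* `jetRegular_of_initIsolatedFam` — **(system-free, base `0`)** tests `t_o ∈ I`, a family
  `u ⊆ (t)` initially isolated to order `2` over `0` ⇒ there is a tangent `γ ∈ ker J₀` (the direction
  of the tree's polar lemma `exists_deflation_direction`, applied to `u` enlarged by the tests) such
  that REG holds for EVERY coefficient field `ξ` with `ξ(0) = γ`.  Mechanism: a vector `p` with
  `J₀ p = 0` kills the linear forms of the order-`1` members (`Σ_o g_o(0)·J₀(o,·)`); if moreover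
  `G_γ p = J₀ ν` then `p` kills the polars `B_o(γ, ·)` of the order-`2` members, because
  `B_o(γ,p) = Σ_{o'} g_{oo'}(0)·(G_γ p)_{o'} = Σ_{o'} g_{oo'}(0)·(J₀ ν)_{o'} = ℓ_o(ν) = 0` — the linear
  form `ℓ_o = Σ g(0) J₀` of a member of GLOBAL order `2` vanishes identically.  So `p` lies in the
  zero fibre of the deflated initial forms, which is `{0}`.
* `EqSystem.jetRegularAt` — **(systems, any base `y`)** `E` correct with test ideal initially
  isolated to order `2` over `y` ⇒ `∃ γ ∈ ker J_C(graphPoint y)` with REG for the translated tests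
  `τ_y^* t_o` and every `ξ` with `ξ(0) = γ` — literally the REG clause of `EqSystem.JetDeflatableAt y`.

Hence (module M18d) rung `K = 2` of bounded-order purification is reduced to LIFT, a statement
about kernel 2-jets of the polynomial matrix `y ↦ J_C(graphPoint y)` that holds wherever its rank
is maximal.

No `sorry`.  Sources: [LeykinVerscheldeZhao2006, Thm. 3.1 (deflation regularises)];
[HauensteinWampler2013, §2]; the tree modules `GraphEquationsPolarLemma` (M15b),
`GraphEquationsDeflation` (M15c), `GraphEquationsTangentDeflation` (M15f).
-/

set_option linter.dupNamespace false

noncomputable section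

open scoped BigOperators

namespace Summit.MatrixMultiplication.MatrixMultiplication.Theorems.GraphEquations

open MvPolynomial
open Literature.Computability.AlgebraicComplexity

variable {n : ℕ}

/-! ## Transport of initial isolation under the translation symmetry -/

/-- `eval 0 ∘ τ_y = eval y` on `ℂ[A,B]`. -/
theorem eval_zero_comp_shiftAB (y : MatMulVars n → ℂ) :
    (eval (0 : MatMulVars n → ℂ)).comp (shiftAB y) = eval y := by
  rw [MvPolynomial.eval_zero, constantCoeff_comp_shiftAB]

/-- **Transport.**  `InitIsolatedFam u K y → InitIsolatedFam (τ_y^* u) K 0`: the translation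
`τ_y` acts on `Ψ`-coordinates by shifting coefficients only, so the data `(ν, map τ_y G)` works and
its specialisation at `0` is the specialisation of `G` at `y`. -/
theorem InitIsolatedFam.translate {T : ℕ} {u : Fin T → MvPolynomial (GraphVars n) ℂ} {K : ℕ}
    {y : MatMulVars n → ℂ} (h : InitIsolatedFam u K y) :
    InitIsolatedFam (fun o => GraphEquations.translate y (u o)) K 0 := by
  obtain ⟨ν, G, hν, hG, hlow, hiso⟩ := h
  have key : ∀ o, map (eval (0 : MatMulVars n → ℂ)) (homogeneousComponent (ν o) (map (shiftAB y) (G o))) =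
      map (eval y) (homogeneousComponent (ν o) (G o)) := fun o => by
    rw [homogeneousComponent_map, map_map, eval_zero_comp_shiftAB]
  refine ⟨ν, fun o => map (shiftAB y) (G o), hν, fun o => ?_, fun o j hj => ?_, fun F₀ hF => ?_⟩
  · rw [← translate_substF, hG]
  · rw [homogeneousComponent_map, hlow o j hj, map_zero]
  · exact hiso F₀ fun o => by rw [← key]; exact hF o

/-! ## Rows and polars of ideal combinations at the origin -/

/-- `(∂f/∂v)(0) = coeff_{v} f`. -/
theorem eval_zero_pderiv (v : GraphVars n) (f : MvPolynomial (GraphVars n) ℂ) :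
    eval 0 (pderiv v f) = coeff (Finsupp.single v 1) f := by
  have h := coeff_pderiv (i := v) f 0
  simp only [zero_add, Finsupp.coe_zero, Pi.zero_apply, Nat.cast_zero, mul_one] at h
  rw [eval_zero, constantCoeff_eq, h]

/-- The entries of `linCoeffC t · F`. -/
theorem linCoeffC_mulVec_apply {T : ℕ} (t : Fin T → MvPolynomial (GraphVars n) ℂ)
    (F : Fin n × Fin n → ℂ) (o : Fin T) :
    (linCoeffC t).mulVec F o = ∑ q, eval 0 (pderiv (Sum.inr q) (t o)) * F q := by
  simp only [Matrix.mulVec, dotProduct, linCoeffC, Matrix.of_apply, eval_zero_pderiv]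

/-- The specialised linear part of `Ψ⁻¹ w` at the base `0`, evaluated at `F`, is the row pairing
`Σ_q (∂w/∂c_q)(0)·F_q`. -/
theorem eval_map_homogeneousComponent_one_liftF_zero (F : Fin n × Fin n → ℂ)
    (w : MvPolynomial (GraphVars n) ℂ) :
    eval F (map (eval (0 : MatMulVars n → ℂ)) (homogeneousComponent 1 (liftF n w))) =
      ∑ q, eval 0 (pderiv (Sum.inr q) w) * F q := by
  rw [eval_map_homogeneousComponent_one_liftF, graphPoint_zero]

/-- **Gradient of an ideal combination at a common zero**:
`(∂(Σ g_i t_i)/∂v)(x) = Σ g_i(x)·(∂t_i/∂v)(x)` when all `t_i(x) = 0`. -/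
theorem eval_pderiv_sum_mul {ι : Type*} (s : Finset ι) (g t : ι → MvPolynomial (GraphVars n) ℂ)
    {x : GraphVars n → ℂ} (ht : ∀ i ∈ s, eval x (t i) = 0) (v : GraphVars n) :
    eval x (pderiv v (∑ i ∈ s, g i * t i)) = ∑ i ∈ s, eval x (g i) * eval x (pderiv v (t i)) := by
  rw [map_sum, map_sum]
  refine Finset.sum_congr rfl fun i hi => ?_
  rw [pderiv_mul, map_add, map_mul, map_mul, ht i hi, mul_zero, zero_add]

/-- `D_ξ` of a finite sum of products (Leibniz). -/
theorem derivC_sum_mul {ι : Type*} (s : Finset ι) (ξ : Fin n × Fin n → MvPolynomial (MatMulVars n) ℂ)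
    (g t : ι → MvPolynomial (GraphVars n) ℂ) :
    derivC ξ (∑ i ∈ s, g i * t i) = ∑ i ∈ s, (derivC ξ (g i) * t i + g i * derivC ξ (t i)) := by
  classical
  have h0 : derivC ξ (0 : MvPolynomial (GraphVars n) ℂ) = 0 := by
    have := derivC_C ξ 0; rwa [C_0] at this
  induction s using Finset.induction_on with
  | empty => simp only [Finset.sum_empty, h0]
  | insert a s ha ih => rw [Finset.sum_insert ha, Finset.sum_insert ha, derivC_add, derivC_mul, ih]

/-- **Polar of an ideal combination at a common zero, paired with a kernel vector**:
if `t_i(x) = 0`, `Σ_q (∂t_i/∂c_q)(x) p_q = 0` and `(D_ξ t_i)(x) = 0` for all `i`, then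
`Σ_q (∂ D_ξ(Σ g_i t_i)/∂c_q)(x)·p_q = Σ_i g_i(x) · Σ_q (∂ D_ξ t_i/∂c_q)(x)·p_q`. -/
theorem sum_eval_pderiv_derivC_sum_mul {ι : Type*} (s : Finset ι)
    (ξ : Fin n × Fin n → MvPolynomial (MatMulVars n) ℂ) (g t : ι → MvPolynomial (GraphVars n) ℂ)
    {x : GraphVars n → ℂ} (p : Fin n × Fin n → ℂ) (ht : ∀ i ∈ s, eval x (t i) = 0)
    (hJp : ∀ i ∈ s, ∑ q, eval x (pderiv (Sum.inr q) (t i)) * p q = 0)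
    (hD : ∀ i ∈ s, eval x (derivC ξ (t i)) = 0) :
    ∑ q, eval x (pderiv (Sum.inr q) (derivC ξ (∑ i ∈ s, g i * t i))) * p q =
      ∑ i ∈ s, eval x (g i) * ∑ q, eval x (pderiv (Sum.inr q) (derivC ξ (t i))) * p q := by
  have hq : ∀ q, eval x (pderiv (Sum.inr q) (derivC ξ (∑ i ∈ s, g i * t i))) =
      ∑ i ∈ s, (eval x (derivC ξ (g i)) * eval x (pderiv (Sum.inr q) (t i)) +
        eval x (g i) * eval x (pderiv (Sum.inr q) (derivC ξ (t i)))) := by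
    intro q
    rw [derivC_sum_mul, map_sum, map_sum]
    refine Finset.sum_congr rfl fun i hi => ?_
    rw [map_add, pderiv_mul, pderiv_mul]
    simp only [map_add, map_mul, ht i hi, hD i hi, mul_zero, zero_add]
  rw [show (∑ q, eval x (pderiv (Sum.inr q) (derivC ξ (∑ i ∈ s, g i * t i))) * p q) =
      ∑ q, ∑ i ∈ s, (eval x (derivC ξ (g i)) * (eval x (pderiv (Sum.inr q) (t i)) * p q) +
        eval x (g i) * (eval x (pderiv (Sum.inr q) (derivC ξ (t i))) * p q)) from
    Finset.sum_congr rfl fun q _ => by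
      rw [hq, Finset.sum_mul]
      exact Finset.sum_congr rfl fun i _ => by ring]
  rw [Finset.sum_comm]
  refine Finset.sum_congr rfl fun i hi => ?_
  rw [Finset.sum_add_distrib, ← Finset.mul_sum, ← Finset.mul_sum, hJp i hi, mul_zero, zero_add]

/-! ## REG from initial isolation to order two (system-free, base `0`) -/

/-- **JET REGULARITY (family level, base `0`).**  Let `t_o` (`o < S`) vanish on `W_n`, and let
`u ⊆ (t_0,…,t_{S-1})` be a finite family initially isolated to order `2` over `0`.  Then there is
`γ ∈ ker J₀` (`J₀ = linCoeffC t = J_C(0)`) such that for EVERY coefficient field `ξ` with `ξ(0) = γ`: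
`J₀ p = 0 ∧ (linCoeffC (D_ξ t)) p = J₀ ν ⇒ p = 0`. -/
theorem jetRegular_of_initIsolatedFam {S T : ℕ} (t : Fin S → MvPolynomial (GraphVars n) ℂ)
    (ht : ∀ o, ∀ x ∈ mmGraph n, eval x (t o) = 0)
    {u : Fin T → MvPolynomial (GraphVars n) ℂ} (hu : ∀ i, u i ∈ Ideal.span (Set.range t))
    (hfam : InitIsolatedFam u 2 0) :
    ∃ γ : Fin n × Fin n → ℂ, (linCoeffC t).mulVec γ = 0 ∧
      ∀ ξ : Fin n × Fin n → MvPolynomial (MatMulVars n) ℂ, (∀ q, eval 0 (ξ q) = γ q) →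
        ∀ p ν : Fin n × Fin n → ℂ, (linCoeffC t).mulVec p = 0 →
          (linCoeffC fun o => derivC ξ (t o)).mulVec p = (linCoeffC t).mulVec ν → p = 0 := by
  classical
  obtain ⟨ν, G, hν, hG, hlow, hiso⟩ := hfam
  -- the members as explicit combinations of the tests
  have hu' : ∀ i, ∃ g : Fin S → MvPolynomial (GraphVars n) ℂ, ∑ o, g o * t o = u i := fun i =>
    Ideal.mem_span_range_iff_exists_fun.mp (hu i)
  choose g hg using hu'
  have h0W : (0 : GraphVars n → ℂ) ∈ mmGraph n := by
    rw [← graphPoint_zero]; exact graphPoint_mem_mmGraph 0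
  have ht0 : ∀ o, eval 0 (t o) = 0 := fun o => ht o 0 h0W
  have hGi : ∀ i, G i = liftF n (u i) := fun i => by rw [← liftF_substF (G i), hG]
  -- rows of the members: `Σ_q (∂u_i/∂c_q)(0) F_q = Σ_o g_io(0) (J₀ F)_o`
  have hrow_u : ∀ i (F : Fin n × Fin n → ℂ),
      ∑ q, eval 0 (pderiv (Sum.inr q) (u i)) * F q = ∑ o, eval 0 (g i o) * (linCoeffC t).mulVec F o := by
    intro i F
    simp_rw [linCoeffC_mulVec_apply, ← hg i, eval_pderiv_sum_mul Finset.univ (g i) t (fun o _ => ht0 o),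
      Finset.sum_mul, Finset.mul_sum, mul_assoc]
    exact Finset.sum_comm
  -- the enlarged family `u ⧺ t` (tests declared at order `1`) and its specialised initial forms
  set ν' : Fin (T + S) → ℕ := Fin.append ν fun _ => 1 with hν'
  set G' : Fin (T + S) → FPoly n := Fin.append G fun o => liftF n (t o) with hG'
  set P : Fin (T + S) → MvPolynomial (Fin n × Fin n) ℂ := fun i =>
    map (eval (0 : MatMulVars n → ℂ)) (homogeneousComponent (ν' i) (G' i)) with hP
  have hPhom : ∀ i, (P i).IsHomogeneous (ν' i) := fun i =>
    (homogeneousComponent_isHomogeneous _ _).map _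
  have hν'2 : ∀ i, ν' i ≤ 2 := fun i => by
    induction i using Fin.addCases with
    | left o => simp only [hν', Fin.append_left]; exact hν o
    | right o => simp only [hν', Fin.append_right]; omega
  have hiso' : ∀ F₀ : Fin n × Fin n → ℂ, (∀ i, eval F₀ (P i) = eval 0 (P i)) → F₀ = 0 :=
    fun F₀ hF => hiso F₀ fun o => by simpa only [hP, hν', hG', Fin.append_left] using hF (Fin.castAdd S o)
  obtain ⟨γ, hγN, hγ⟩ := exists_deflation_direction P ν' hPhom hν'2 hiso'
  -- the test members: `P = row pairing`
  have hPt : ∀ (o : Fin S) (F : Fin n × Fin n → ℂ), eval F (P (Fin.natAdd T o)) = (linCoeffC t).mulVec F o := by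
    intro o F
    simp only [hP, hν', hG', Fin.append_right, eval_map_homogeneousComponent_one_liftF_zero,
      linCoeffC_mulVec_apply]
  -- tangency: `γ ∈ ker J₀`
  have hJγ : (linCoeffC t).mulVec γ = 0 := by
    funext o
    have h := hγN (Fin.natAdd T o) (by simp only [hν', Fin.append_right])
    rw [hPt] at h
    exact h
  refine ⟨γ, hJγ, fun ξ hξ p ν₀ hJp hGp => hγ p (fun i hi => ?_) (fun i hi => ?_)⟩
  · -- order-1 members vanish at `p`
    induction i using Fin.addCases with
    | left i₀ =>
      simp only [hν', Fin.append_left] at hi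
      simp only [hP, hν', hG', Fin.append_left, hi, hGi, eval_map_homogeneousComponent_one_liftF_zero,
        hrow_u, hJp, Pi.zero_apply, mul_zero, Finset.sum_const_zero]
    | right o => rw [hPt, hJp]; rfl
  · -- polars of order-2 members vanish at `p`
    induction i using Fin.addCases with
    | right o => simp only [hν', Fin.append_right] at hi; omega
    | left i₀ =>
      simp only [hν', Fin.append_left] at hi
      have hξ' : (fun q => eval (0 : MatMulVars n → ℂ) (ξ q)) = γ := funext hξ
      -- `polarDeriv γ (P) = specialised linear part of Ψ⁻¹ (D_ξ u_i₀)`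
      have hpol : polarDeriv γ (P (Fin.castAdd S i₀)) =
          map (eval (0 : MatMulVars n → ℂ)) (homogeneousComponent 1 (liftF n (derivC ξ (u i₀)))) := by
        simp only [hP, hν', hG', Fin.append_left, hi, hGi]
        have h1 : liftF n (derivC ξ (u i₀)) = polarDeriv ξ (liftF n (u i₀)) := by
          rw [← liftF_substF (polarDeriv ξ (liftF n (u i₀))), substF_polarDeriv, substF_liftF]
        rw [h1, homogeneousComponent_polarDeriv, map_polarDeriv, hξ']
      rw [hpol, eval_map_homogeneousComponent_one_liftF_zero, ← hg i₀]
      -- hypotheses of the polar lemma for combinations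
      have hJp' : ∀ o ∈ (Finset.univ : Finset (Fin S)), ∑ q, eval 0 (pderiv (Sum.inr q) (t o)) * p q = 0 := by
        intro o _
        have := congrFun hJp o
        rwa [linCoeffC_mulVec_apply] at this
      have hD : ∀ o ∈ (Finset.univ : Finset (Fin S)), eval 0 (derivC ξ (t o)) = 0 := by
        intro o _
        have h := eval_graphPoint_derivC 0 ξ (t o)
        rw [graphPoint_zero] at h
        rw [h]
        have := congrFun hJγ o
        rw [linCoeffC_mulVec_apply, Pi.zero_apply] at this
        simp_rw [hξ]
        rw [← this]
        exact Finset.sum_congr rfl fun q _ => mul_comm _ _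
      rw [sum_eval_pderiv_derivC_sum_mul Finset.univ ξ (g i₀) t p (fun o _ => ht0 o) hJp' hD]
      -- `(G p)_o = (J₀ ν₀)_o`
      have hGo : ∀ o, ∑ q, eval 0 (pderiv (Sum.inr q) (derivC ξ (t o))) * p q = (linCoeffC t).mulVec ν₀ o := by
        intro o
        have := congrFun hGp o
        rwa [linCoeffC_mulVec_apply] at this
      simp_rw [hGo]
      -- `Σ_o g(0) (J₀ ν₀)_o = ℓ_{i₀}(ν₀) = 0` since the member has global order 2
      rw [← hrow_u, ← eval_map_homogeneousComponent_one_liftF_zero, ← hGi,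
        hlow i₀ 1 (by omega), map_zero, map_zero]

/-! ## Systems, any base -/

namespace EqSystem

/-- **JET REGULARITY over a base `y`.**  `E` correct, test ideal initially isolated to order `2`
over `y` ⇒ there is a tangent `γ ∈ ker J_C(graphPoint y)` such that for every coefficient field `ξ`
with `ξ(0) = γ` the REG clause of `JetDeflatableAt y` holds for the translated tests `τ_y^* t_o`. -/
theorem jetRegularAt {E : EqSystem n} (hE : E.Correct) {y : MatMulVars n → ℂ}
    (h : E.IdealInitIsolatedAt 2 y) :
    ∃ γ : Fin n × Fin n → ℂ, (E.jacobianC (graphPoint y)).mulVec γ = 0 ∧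
      ∀ ξ : Fin n × Fin n → MvPolynomial (MatMulVars n) ℂ, (∀ q, eval 0 (ξ q) = γ q) →
        ∀ p ν : Fin n × Fin n → ℂ, (E.jacobianC (graphPoint y)).mulVec p = 0 →
          (linCoeffC fun o : Fin E.tests.length =>
              derivC ξ (GraphEquations.translate y (E.testPoly (E.tests.get o)))).mulVec p =
            (E.jacobianC (graphPoint y)).mulVec ν → p = 0 := by
  classical
  obtain ⟨T, u, hu, hfam⟩ := h
  set t : Fin E.tests.length → MvPolynomial (GraphVars n) ℂ := fun o =>
    GraphEquations.translate y (E.testPoly (E.tests.get o)) with htdef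
  have hJ : linCoeffC t = E.jacobianC (graphPoint y) := linCoeffC_bind₁_shift E (graphPoint y)
  have ht : ∀ o, ∀ x ∈ mmGraph n, eval x (t o) = 0 := fun o x hx =>
    eval_bind₁_shift_eq_zero (graphPoint_mem_mmGraph y)
      (fun z hz => hE.eval_testPoly_eq_zero hz (List.get_mem _ _)) hx
  have hu' : ∀ i, GraphEquations.translate y (u i) ∈ Ideal.span (Set.range t) := by
    intro i
    obtain ⟨g, hg⟩ := Ideal.mem_span_range_iff_exists_fun.mp (hu i)
    rw [← hg, GraphEquations.translate, map_sum]
    refine Ideal.sum_mem _ fun o _ => ?_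
    rw [map_mul]
    exact Ideal.mul_mem_left _ _ (Ideal.subset_span ⟨o, rfl⟩)
  obtain ⟨γ, hγ, hreg⟩ := jetRegular_of_initIsolatedFam t ht hu' hfam.translate
  rw [hJ] at hγ hreg
  exact ⟨γ, hγ, hreg⟩

end EqSystem

end Summit.MatrixMultiplication.MatrixMultiplication.Theorems.GraphEquations

end
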